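import Summits.AtomisticToContinuum.HydrodynamicLimit.Theorems.CollisionIsometryCLTCollisionalTransferLocalityEquilibriumRungWindowGlue
import Summits.AtomisticToContinuum.HydrodynamicLimit.Theorems.CollisionIsometryCLTCollisionalTransferLocalityEnskogWindowBound
import Summits.AtomisticToContinuum.HydrodynamicLimit.Theorems.CollisionIsometryCLTCollisionalTransferLocalityMollifiedCeilingConst
import Summits.AtomisticToContinuum.HydrodynamicLimit.Theorems.CollisionIsometryCLTCollisionalTransferLocalityVirialTailConst
import Summits.AtomisticToContinuum.HydrodynamicLimit.Theorems.CollisionIsometryCLTCollisionalTransferLocalityCompressibilityLinear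
import Summits.AtomisticToContinuum.HydrodynamicLimit.Theorems.CollisionIsometryCLTCollisionalTransferLocalityRhsSupOfConstLLN
import Summits.AtomisticToContinuum.HydrodynamicLimit.Theorems.CollisionIsometryCLTCollisionalTransferLocalityEquilibriumSupOfRhsSup
import Summits.AtomisticToContinuum.HydrodynamicLimit.Theorems.CollisionIsometryCLTCollisionalTransferLocalityBlockDensityLLNConst
import Summits.AtomisticToContinuum.HydrodynamicLimit.Theorems.CollisionIsometryCLTCollisionalTransferLocalityBlockVelocityLLNConst
import Summits.AtomisticToContinuum.HydrodynamicLimit.Theorems.CollisionIsometryCLTCollisionalTransferLocalityConstLLNOfParts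
import Summits.AtomisticToContinuum.HydrodynamicLimit.Theorems.JParityClosureEvenStressEnskogValueFree
import HarnessLib

/-!
# THE EQUILIBRIUM RUNG OF THE CRUX, UNCONDITIONALLY — assembly
(line `hemisphere-affine-slaving`, crux `CollisionalTransferLocality`, stmt-AtomisticToContinuum-9518)

Helper file (`--supports stmt-AtomisticToContinuum-9518`; registered helper `equilibriumRungFlow_unconditional`), the
second of two modules re-landing seat c8's `…EquilibriumRungAssembly` (p136415, bounced only because the gate restarted
while it was in flight; module I is `…EquilibriumRungWindowGlue`, p167842). For every temperature `θ > 0` there is `σ₀ > 0` such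
that for `0 < σ < σ₀` and EVERY hard-sphere flow family `Φ` the crux's conclusion `ConclusionAtFlow σ 1 θ 0 Φ` — the
local-equilibrium closure of the collisional momentum + energy transfer tested against all smooth `(ψ, χ)`, uniformly
in `τ ≤ t`, in probability — holds under the homogeneous local Gibbs law of activity `1`, velocity `0`, temperature
`θ` (`Disproof.EquilibriumRung` up to `Iff.rfl`). Inputs are LANDED theorems only:

* `noVirialBurstsConst_of` — [WB]₀, window-burst control of the weighted collision virial `V_N` at equilibrium from
  the conclusion of the sibling crux `EvenStressEnskog` at constant profiles (here fed with the UNCONDITIONAL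
  `EvenStressEnskog.evenStressEnskog_rung0`), the pathwise window domination [PW-a] (`EqRungGlue.windowDomination`,
  module I), the Enskog window bound [PW-b] (`stub_enskogWindowBound`, p132356), the mollified ceiling [MC]
  (`stub_mollifiedCeilingConst`, p132076), the fast-particle tail [TL] (`stub_virialTailConst`, p132116), the energy
  cap [E] (`stub_energyAllTimes`, p117570) and the linear `Z`-bound [Z] (`stub_hsCompressibility_linear`, p117576).
  Parameter order: `η_c := min η₀ η_Z`; `σ₀ := min` of the three radii, `η_c/4` and `1/2` (so `4σ³ ≤ η_c`); given
  `δ, ε`: energy level `E₀`, tail level `L` ([TL] at `(δ/2, ε/4)`), the constant `C` of [PW-b] (independent of `r`),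
  grid size `n` with `(1 + 2L)·3C E₀ t/n ≤ δ/4`, accuracy `η' := δ/(24(1 + 2L))` and budget `ε/(12n)` per (grid time,
  trace mark), THEN the mollifier radius `r < r₀` uniformly over the `n` grid times (`exists_uniform_radius`), then
  `N` large; union bound over the good-set complement (null), energy, ceiling, tail and the `3n` even-statistic events.
* `constLLN_of` — [CL], the constant-profile mesoscopic LLN with identified limit, from [CL-ρ]
  (`stub_blockDensityLLNConst`, p135857), [CL-v] (`stub_blockVelocityLLNConst`, p135595) and [CL-asm]
  (`stub_constLLN_of_parts`, p134699); mass one from `isProbabilityMeasure_localGibbsLaw`.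
* `equilibriumRungFlow_unconditional` — the registered helper: [R0c] (`stub_rhsSup_of_constLLN`, p134580) fed with
  `constLLN_of`, [ERc] (`stub_equilibriumSup_of_rhsSup`, p134600) fed with that and with `noVirialBurstsConst_of`;
  `σ₀ := min σ_[WB]₀ σ_[ERc]`; the conclusion is the crux's `let`-telescope (`conclusionAtFlow_iff`).

References: S. Chapman, T. G. Cowling, *The Mathematical Theory of Non-uniform Gases* (1970), Ch. 16; H. Spohn,
*Large Scale Dynamics of Interacting Particles* (1991), Part I §2.3 (local equilibrium of the hard-sphere gas). The
probabilistic content is a finite union bound; everything else is by name.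
-/

namespace Summit.AtomisticToContinuum.HydrodynamicLimit.Theorems.HemisphereAffineSlaving

open scoped BigOperators Topology Classical ENNReal InnerProductSpace
open Filter Set Function MeasureTheory

noncomputable section

open Literature.MathematicalPhysics.KineticTheory (T3 V3)
open Literature.Analysis.FunctionSpaces

/-! ## Window-burst control of the collision virial at equilibrium -/

/-- [WB]₀ **Window-burst control of the collision virial AT EQUILIBRIUM from the sibling crux `EvenStressEnskog` at constant
profiles** (the lead's glue of v11.1). Given the rung-0 conclusion of the sibling crux `EvenStressEnskog` (hypothesis `h79`:
the even collision statistic of every `Ξ^{kl}`, with any continuous `χ` and any cutoff `g` vanishing above `η₀`, is small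
in probability at each fixed positive time for small mollifier radii), the pathwise window domination [PW-a]
(`EqRungGlue.windowDomination`), the Enskog window bound [PW-b], the mollified ceiling [MC], the fast-particle tail [TL],
the energy cap [E] and the linear `Z`-bound [Z] (all landed, by name):
for every `θ > 0` there is `σ₀ > 0` such that for `0 < σ < σ₀`, every flow family and `t > 0`, the window increments of
`V_N` on a fine grid are small w.h.p. Parameter order: `η_c := min η₀ η_Z`; `σ₀ := min` of the three radii, `η_c/4` and
`1/2` (so `4σ³ ≤ η_c`); given `δ, ε`: energy level `E₀`, tail level `L` ([TL] at `(δ/2, ε/4)`), the constant `C` of [PW-b]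
(independent of `r`), grid size `n` with `(1 + 2L)·3C E₀ t/n ≤ δ/4`, accuracy `η' := δ/(24(1 + 2L))` and budget
`ε/(12n)` per (grid time, trace mark), THEN the mollifier radius `r < r₀` uniformly over the `n` grid times
(`exists_uniform_radius`), then `N` large; union bound over good-set complement (null), energy, ceiling, tail and the
`3n` even-statistic events. [folklore] -/
theorem noVirialBurstsConst_of
    (h79 : (∃ η₀ : ℝ, 0 < η₀ ∧ ∀ (a θ : ℝ) (u : V3), 0 < a → 0 < θ → ∃ σ₀ : ℝ, 0 < σ₀ ∧ ∀ σ : ℝ, 0 < σ → σ < σ₀ → ∀ Φ : (N : ℕ) → Literature.Analysis.FluidPDE.HardSphereFlow (Literature.Analysis.FluidPDE.Torus.geometry (Fin 3)) (Literature.MathematicalPhysics.KineticTheory.hsDiameter σ N) (N + 1), ∀ τ : ℝ, 0 < τ → ∀ χ : ℝ × UnitAddTorus (Fin 3) → ℝ, Continuous χ → ∀ g : ℝ → ℝ, Continuous g → (∀ a, η₀ ≤ a → g a = 0) → ∀ η δ : ℝ, 0 < η → 0 < δ → ∃ r₀ : ℝ, 0 < r₀ ∧ ∀ r : ℝ, 0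 < r → r < r₀ → ∃ N₀ : ℕ, ∀ N : ℕ, N₀ ≤ N → ∀ k l : Fin 3, Literature.MathematicalPhysics.KineticTheory.localGibbsLaw σ (fun _ => a) (fun _ => u) (fun _ => θ) N (Φ N) {z | η < |Literature.MathematicalPhysics.KineticTheory.evenStat σ N (Φ N) τ χ g (Literature.MathematicalPhysics.KineticTheory.evenMark k l) r z|} ≤ ENNReal.ofReal δ))
    :
    ∀ θ : ℝ, 0 < θ → ∃ σ₀ : ℝ, 0 < σ₀ ∧ ∀ σ : ℝ, 0 < σ → σ < σ₀ → ∀ (Φ : Flows σ) (t : ℝ), 0 < t →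
      ∀ δ ε : ℝ, 0 < δ → 0 < ε → ∃ n : ℕ, 0 < n ∧ ∀ᶠ N : ℕ in atTop,
        Literature.MathematicalPhysics.KineticTheory.localGibbsLaw σ (fun _ => 1) (fun _ => 0) (fun _ => θ) N (Φ N)
          {z | ∃ k : ℕ, k < n ∧ δ < virialW σ Φ N z ((k + 1) * (t / n)) - virialW σ Φ N z (k * (t / n))} ≤
          ENNReal.ofReal ε := by
  intro θ hθ
  obtain ⟨η₀, hη₀, H79⟩ := h79
  obtain ⟨ηZ, hηZ, K, hK0, hZK⟩ := stub_hsCompressibility_linear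
  set ηc : ℝ := min η₀ ηZ with hηc
  have hηc0 : 0 < ηc := lt_min hη₀ hηZ
  have hηcZ : ηc ≤ ηZ := min_le_right _ _
  have hηc1 : ηc ≤ η₀ := min_le_left _ _
  obtain ⟨σ₁, hσ₁, H1⟩ := H79 1 θ 0 one_pos hθ
  obtain ⟨σ₂, hσ₂, H2⟩ := stub_mollifiedCeilingConst θ hθ
  obtain ⟨σ₃, hσ₃, H3⟩ := stub_virialTailConst θ hθ
  refine ⟨min (min σ₁ σ₂) (min σ₃ (min (ηc / 4) (1 / 2))),
    lt_min (lt_min hσ₁ hσ₂) (lt_min hσ₃ (lt_min (by positivity) (by norm_num))), ?_⟩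
  intro σ hσ hlt Φ t ht δ ε hδ hε
  have hlt1 : σ < σ₁ := lt_of_lt_of_le hlt ((min_le_left _ _).trans (min_le_left _ _))
  have hlt2 : σ < σ₂ := lt_of_lt_of_le hlt ((min_le_left _ _).trans (min_le_right _ _))
  have hlt3 : σ < σ₃ := lt_of_lt_of_le hlt ((min_le_right _ _).trans (min_le_left _ _))
  have hltc : σ < ηc / 4 := lt_of_lt_of_le hlt ((min_le_right _ _).trans ((min_le_right _ _).trans (min_le_left _ _)))
  have hhalf' : σ < 1 / 2 := lt_of_lt_of_le hlt ((min_le_right _ _).trans ((min_le_right _ _).trans (min_le_right _ _)))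
  have hhalf : σ ≤ 1 / 2 := hhalf'.le
  have h4σ : 4 * σ ^ 3 ≤ ηc := by
    have hσ1 : σ ≤ 1 := by linarith
    have h3 : σ ^ 3 ≤ σ := by
      have : σ ^ 3 = σ * (σ * σ) := by ring
      rw [this]
      calc σ * (σ * σ) ≤ σ * (1 * 1) := by gcongr
        _ = σ := by ring
    linarith
  have hP : NiceProfiles (fun _ : T3 => (1 : ℝ)) (fun _ => θ) (fun _ => (0 : V3)) :=
    ⟨continuous_const, continuous_const, continuous_const, fun _ => one_pos, fun _ => hθ⟩
  obtain ⟨E₀, hE₀, HE⟩ := stub_energyAllTimes _ _ _ hP σ hσ hhalf Φ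
  obtain ⟨C, hC0, HEW⟩ := stub_enskogWindowBound σ hσ hhalf ηZ K ηc hηZ hK0 hZK hηc0 hηcZ
  have HWD := EqRungGlue.windowDomination σ hσ ηc hηc0
  -- tail level `L`
  obtain ⟨L₀, HL⟩ := H3 σ hσ hlt3 Φ t ht (δ / 2) (ε / 4) (by positivity) (by positivity)
  set L : ℝ := max L₀ 1 with hL
  have hL0 : 0 < L := lt_of_lt_of_le one_pos (le_max_right _ _)
  have hL1 : L₀ ≤ L := le_max_left _ _
  have h2L : 0 < 1 + 2 * L := by positivity
  -- grid size `n`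
  obtain ⟨n, hn⟩ := exists_nat_gt (12 * (1 + 2 * L) * C * E₀ * t / δ)
  have hnum0 : 0 ≤ 12 * (1 + 2 * L) * C * E₀ * t / δ := by positivity
  have hnR : (0 : ℝ) < n := hnum0.trans_lt hn
  have hn0 : 0 < n := by exact_mod_cast hnR
  have hwin : (1 + 2 * L) * (3 * (C * E₀ * (t / n))) ≤ δ / 4 := by
    rw [div_lt_iff₀ hδ] at hn
    rw [show (1 + 2 * L) * (3 * (C * E₀ * (t / n))) = (12 * (1 + 2 * L) * C * E₀ * t) / (4 * n) by
      field_simp; ring]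
    rw [div_le_iff₀ (by positivity)]
    nlinarith
  -- accuracy `η'` per grid evaluation
  set η' : ℝ := δ / (24 * (1 + 2 * L)) with hη'
  have hη'0 : 0 < η' := by positivity
  have hη'win : (1 + 2 * L) * (6 * η') = δ / 4 := by
    rw [hη']; field_simp; ring
  -- the cutoff `g` and the test `χ ≡ 1`
  set g : ℝ → ℝ := fun a => max 0 (min 1 (2 - 2 * a / ηc)) with hg
  have hgc : Continuous g := by
    rw [hg]; fun_prop
  have hg0 : ∀ a, η₀ ≤ a → g a = 0 := by
    intro a ha
    have hle : 2 - 2 * a / ηc ≤ 0 := by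
      rw [sub_nonpos, le_div_iff₀ hηc0]
      nlinarith [hηc1.trans ha]
    have hmin : min 1 (2 - 2 * a / ηc) ≤ 0 := (min_le_right _ _).trans hle
    show max 0 (min 1 (2 - 2 * a / ηc)) = 0
    exact max_eq_left hmin
  -- budget per (grid time, trace mark) and the uniform radius
  set δ' : ℝ := ε / (4 * (3 * n)) with hδ'
  have hδ'0 : 0 < δ' := by positivity
  set P : (N : ℕ) → Measure (Cfg N) := fun N =>
    Literature.MathematicalPhysics.KineticTheory.localGibbsLaw σ (fun _ => 1) (fun _ => 0) (fun _ => θ) N (Φ N) with hPdef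
  have hr0 : ∀ m : Fin n, ∃ r₀ : ℝ, 0 < r₀ ∧ ∀ r : ℝ, 0 < r → r < r₀ → ∃ N₀ : ℕ, ∀ N : ℕ, N₀ ≤ N →
      ∀ k l : Fin 3, P N {z | η' < |Literature.MathematicalPhysics.KineticTheory.evenStat σ N (Φ N) ((((m : ℕ) : ℝ) + 1) * (t / n))
        (fun _ : ℝ × T3 => (1 : ℝ)) g (Literature.MathematicalPhysics.KineticTheory.evenMark k l) r z|} ≤ ENNReal.ofReal δ' :=
    fun m => H1 σ hσ hlt1 Φ ((((m : ℕ) : ℝ) + 1) * (t / n)) (by positivity) (fun _ => (1 : ℝ)) continuous_const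
      g hgc hg0 η' δ' hη'0 hδ'0
  obtain ⟨r₀, hr₀, Hr⟩ := exists_uniform_radius hn0 hr0
  set r : ℝ := min (r₀ / 2) (1 / 8) with hr
  have hr0' : 0 < r := lt_min (half_pos hr₀) (by norm_num)
  have hrr₀ : r < r₀ := (min_le_left _ _).trans_lt (half_lt_self hr₀)
  have hr4 : r < 1 / 4 := (min_le_right _ _).trans_lt (by norm_num)
  -- the five families of events
  set Aev : (N : ℕ) → Fin n × Fin 3 → Set (Cfg N) := fun N p =>
    {z | η' < |Literature.MathematicalPhysics.KineticTheory.evenStat σ N (Φ N) ((((p.1 : ℕ) : ℝ) + 1) * (t / n))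
      (fun _ : ℝ × T3 => (1 : ℝ)) g (Literature.MathematicalPhysics.KineticTheory.evenMark p.2 p.2) r z|} with hAev
  set Eev : (N : ℕ) → Set (Cfg N) := fun N =>
    {z | ∃ s ∈ Icc 0 t, E₀ < ((N : ℝ) + 1)⁻¹ * Literature.Analysis.FluidPDE.configEnergy ((Φ N).flow s z)} with hEev
  set Mev : (N : ℕ) → Set (Cfg N) := fun N =>
    {z | ∃ s ∈ Icc 0 t, ∃ x : T3, 2 < Literature.MathematicalPhysics.KineticTheory.mollDensity r ((Φ N).flow s z) x} with hMev
  set Tev : (N : ℕ) → Set (Cfg N) := fun N =>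
    {z | δ / 2 < ((N : ℝ) + 1)⁻¹ * (Φ N).collisionPairSum (Ioc 0 t)
      (fun s w i j => if L < ‖(w i).2‖ ∨ L < ‖(w j).2‖ then virialK σ N s w i j else 0) z} with hTev
  have hA : ∀ p : Fin n × Fin 3, ∀ᶠ N : ℕ in atTop, P N (Aev N p) ≤ ENNReal.ofReal δ' := by
    rintro ⟨m, k⟩
    obtain ⟨N₀, HN⟩ := Hr m r hr0' hrr₀
    exact Filter.eventually_atTop.2 ⟨N₀, fun N hN => HN N hN k k⟩
  have hA' : ∀ᶠ N : ℕ in atTop, ∀ p : Fin n × Fin 3, P N (Aev N p) ≤ ENNReal.ofReal δ' :=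
    Filter.eventually_all.2 hA
  have hε4 : (0 : ℝ≥0∞) < ENNReal.ofReal (ε / 4) := ENNReal.ofReal_pos.2 (by positivity)
  have hE' : ∀ᶠ N : ℕ in atTop, P N (Eev N) ≤ ENNReal.ofReal (ε / 4) :=
    ((tendsto_order.1 (HE t)).2 _ hε4).mono fun N hN => hN.le
  have hM' : ∀ᶠ N : ℕ in atTop, P N (Mev N) ≤ ENNReal.ofReal (ε / 4) :=
    ((tendsto_order.1 (H2 σ hσ hlt2 Φ t r ht hr0' hr4)).2 _ hε4).mono fun N hN => hN.le
  have hT' : ∀ N : ℕ, P N (Tev N) ≤ ENNReal.ofReal (ε / 4) := fun N => HL L hL1 N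
  refine ⟨n, hn0, ?_⟩
  filter_upwards [hA', hE', hM'] with N hNA hNE hNM
  -- the cover at this `N`
  have hcover : {z : Cfg N | ∃ k : ℕ, k < n ∧
      δ < virialW σ Φ N z ((k + 1) * (t / n)) - virialW σ Φ N z (k * (t / n))} ⊆
      (Φ N).goodᶜ ∪ (Eev N ∪ (Mev N ∪ (Tev N ∪ ⋃ p : Fin n × Fin 3, Aev N p))) := by
    rintro z ⟨k, hk, hzk⟩
    by_cases hz : z ∈ (Φ N).good
    swap
    · exact Or.inl hz
    right
    by_contra hno
    simp only [Set.mem_union, Set.mem_iUnion, hEev, hMev, hTev, hAev, Set.mem_setOf_eq, not_or, not_exists,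
      not_and, not_lt] at hno
    obtain ⟨hnE, hnM, hnT, hnA⟩ := hno
    have hnE' : ∀ s ∈ Icc 0 t, ((N : ℝ) + 1)⁻¹ * Literature.Analysis.FluidPDE.configEnergy ((Φ N).flow s z) ≤ E₀ :=
      fun s hs => hnE s hs
    have hnM' : ∀ s ∈ Icc 0 t, ∀ x : T3, Literature.MathematicalPhysics.KineticTheory.mollDensity r ((Φ N).flow s z) x ≤ 2 :=
      fun s hs x => hnM s hs x
    obtain ⟨hpos, hdom⟩ := HWD r L hL0 Φ N z hz t hnM' h4σ
    have hens := HEW r E₀ hr0' hr4 hE₀ Φ N z hz t ht hnE' hnM'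
    have hkn : (k : ℝ) + 1 ≤ n := by exact_mod_cast Nat.succ_le_of_lt hk
    have hτ0 : (0 : ℝ) ≤ k * (t / n) := by positivity
    have hττ' : (k : ℝ) * (t / n) ≤ (k + 1) * (t / n) := by
      have : (0 : ℝ) ≤ t / n := by positivity
      nlinarith
    have hτ't : ((k : ℝ) + 1) * (t / n) ≤ t := by
      calc ((k : ℝ) + 1) * (t / n) ≤ n * (t / n) := by gcongr
        _ = t := by field_simp
    have hwidth : ((k : ℝ) + 1) * (t / n) - k * (t / n) = t / n := by ring
    have hD := hdom _ _ hτ0 hττ' hτ't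
    -- the three even collision sums over the window
    have hK : ∀ κ : Fin 3,
        Literature.MathematicalPhysics.KineticTheory.collisionSum σ N (Φ N) (((k : ℝ) + 1) * (t / n)) (fun _ : ℝ × T3 => (1 : ℝ)) g (Literature.MathematicalPhysics.KineticTheory.evenMark κ κ) r z -
          Literature.MathematicalPhysics.KineticTheory.collisionSum σ N (Φ N) ((k : ℝ) * (t / n)) (fun _ : ℝ × T3 => (1 : ℝ)) g (Literature.MathematicalPhysics.KineticTheory.evenMark κ κ) r z ≤
          2 * η' + C * E₀ * (t / n) := by
      intro κ
      have hes := hens κ _ _ hτ0 hττ' hτ't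
      rw [hwidth] at hes
      have h1 : |Literature.MathematicalPhysics.KineticTheory.evenStat σ N (Φ N) (((k : ℝ) + 1) * (t / n)) (fun _ : ℝ × T3 => (1 : ℝ)) g (Literature.MathematicalPhysics.KineticTheory.evenMark κ κ) r z|
          ≤ η' := by
        have := hnA (⟨k, hk⟩, κ)
        simpa using this
      have hdef1 := Literature.MathematicalPhysics.KineticTheory.evenStat_def σ N (Φ N) (((k : ℝ) + 1) * (t / n)) (fun _ : ℝ × T3 => (1 : ℝ)) g
        (Literature.MathematicalPhysics.KineticTheory.evenMark κ κ) r z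
      rcases Nat.eq_zero_or_pos k with rfl | hkpos
      · -- first window: the sum at time `0` is nonnegative, the Enskog integral over `[0, 0]` vanishes
        have h0 := hpos κ ((0 : ℕ) * (t / n))
        have hes0 : |σ ^ 3 * ∫ s in Icc 0 ((((0 : ℕ) : ℝ) + 1) * (t / n)), Literature.MathematicalPhysics.KineticTheory.enskogRate σ N
            (fun _ : ℝ × T3 => (1 : ℝ)) g (Literature.MathematicalPhysics.KineticTheory.evenMark κ κ) r s ((Φ N).flow s z)| ≤ C * E₀ * (t / n) := by
          have h00 : σ ^ 3 * ∫ s in Icc 0 (((0 : ℕ) : ℝ) * (t / n)), Literature.MathematicalPhysics.KineticTheory.enskogRate σ N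
              (fun _ : ℝ × T3 => (1 : ℝ)) g (Literature.MathematicalPhysics.KineticTheory.evenMark κ κ) r s ((Φ N).flow s z) = 0 := by
            rw [Nat.cast_zero, zero_mul, setIntegral_Icc_self_eq_zero, mul_zero]
          simpa [h00] using hes
        push_cast at h1 hdef1 hes0 h0 ⊢
        have e1 := (abs_le.mp h1).2
        have e2 := (abs_le.mp hes0).2
        linarith [hdef1]
      · -- later windows: both ends are grid evaluations
        have h2 : |Literature.MathematicalPhysics.KineticTheory.evenStat σ N (Φ N) ((k : ℝ) * (t / n)) (fun _ : ℝ × T3 => (1 : ℝ)) g (Literature.MathematicalPhysics.KineticTheory.evenMark κ κ) r z|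
            ≤ η' := by
          have := hnA (⟨k - 1, by omega⟩, κ)
          have hcast : (((k - 1 : ℕ) : ℝ) + 1) = k := by
            rw [Nat.cast_sub hkpos]; push_cast; ring
          simpa [hcast] using this
        have hdef2 := Literature.MathematicalPhysics.KineticTheory.evenStat_def σ N (Φ N) ((k : ℝ) * (t / n)) (fun _ : ℝ × T3 => (1 : ℝ)) g
          (Literature.MathematicalPhysics.KineticTheory.evenMark κ κ) r z
        have e1 := (abs_le.mp h1).2
        have e2 := (abs_le.mp h2).1
        have e3 := (abs_le.mp hes).2
        linarith [hdef1, hdef2]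
    have hsumK : ∑ κ : Fin 3,
        (Literature.MathematicalPhysics.KineticTheory.collisionSum σ N (Φ N) (((k : ℝ) + 1) * (t / n)) (fun _ : ℝ × T3 => (1 : ℝ)) g (Literature.MathematicalPhysics.KineticTheory.evenMark κ κ) r z -
          Literature.MathematicalPhysics.KineticTheory.collisionSum σ N (Φ N) ((k : ℝ) * (t / n)) (fun _ : ℝ × T3 => (1 : ℝ)) g (Literature.MathematicalPhysics.KineticTheory.evenMark κ κ) r z) ≤
        3 * (2 * η' + C * E₀ * (t / n)) := by
      calc _ ≤ ∑ _κ : Fin 3, (2 * η' + C * E₀ * (t / n)) := Finset.sum_le_sum fun κ _ => hK κ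
        _ = 3 * (2 * η' + C * E₀ * (t / n)) := by
            rw [Finset.sum_const, Finset.card_univ, Fintype.card_fin, nsmul_eq_mul]; push_cast; ring
    have hTz : ((N : ℝ) + 1)⁻¹ * (Φ N).collisionPairSum (Ioc 0 t)
        (fun s w i j => if L < ‖(w i).2‖ ∨ L < ‖(w j).2‖ then virialK σ N s w i j else 0) z ≤ δ / 2 := hnT
    have hfin : virialW σ Φ N z (((k : ℝ) + 1) * (t / n)) - virialW σ Φ N z ((k : ℝ) * (t / n)) ≤ δ := by
      have hmul : (1 + 2 * L) * ∑ κ : Fin 3,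
          (Literature.MathematicalPhysics.KineticTheory.collisionSum σ N (Φ N) (((k : ℝ) + 1) * (t / n)) (fun _ : ℝ × T3 => (1 : ℝ)) g (Literature.MathematicalPhysics.KineticTheory.evenMark κ κ) r z -
            Literature.MathematicalPhysics.KineticTheory.collisionSum σ N (Φ N) ((k : ℝ) * (t / n)) (fun _ : ℝ × T3 => (1 : ℝ)) g (Literature.MathematicalPhysics.KineticTheory.evenMark κ κ) r z) ≤
          (1 + 2 * L) * (3 * (2 * η' + C * E₀ * (t / n))) := mul_le_mul_of_nonneg_left hsumK h2L.le
      have hsplit : (1 + 2 * L) * (3 * (2 * η' + C * E₀ * (t / n))) =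
          (1 + 2 * L) * (6 * η') + (1 + 2 * L) * (3 * (C * E₀ * (t / n))) := by ring
      linarith [hD, hmul, hsplit, hη'win, hwin, hTz]
    exact absurd hzk (not_lt.2 (by exact_mod_cast hfin))
  -- the union bound at this `N`
  have hgood : P N (Φ N).goodᶜ = 0 := by
    rw [hPdef]; exact localGibbsLaw_compl_good' (Φ N)
  have hAsum : P N (⋃ p : Fin n × Fin 3, Aev N p) ≤ ENNReal.ofReal (ε / 4) := by
    calc P N (⋃ p : Fin n × Fin 3, Aev N p) ≤ ∑ p : Fin n × Fin 3, P N (Aev N p) := measure_iUnion_fintype_le _ _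
      _ ≤ ∑ _p : Fin n × Fin 3, ENNReal.ofReal δ' := Finset.sum_le_sum fun p _ => hNA p
      _ = ENNReal.ofReal (ε / 4) := by
        rw [Finset.sum_const, Finset.card_univ, Fintype.card_prod, Fintype.card_fin, Fintype.card_fin,
          nsmul_eq_mul, ← ENNReal.ofReal_natCast, ← ENNReal.ofReal_mul (by positivity)]
        congr 1
        rw [hδ']; push_cast; field_simp
  calc P N {z : Cfg N | ∃ k : ℕ, k < n ∧ δ < virialW σ Φ N z ((k + 1) * (t / n)) - virialW σ Φ N z (k * (t / n))}
      ≤ P N ((Φ N).goodᶜ ∪ (Eev N ∪ (Mev N ∪ (Tev N ∪ ⋃ p : Fin n × Fin 3, Aev N p)))) := measure_mono hcover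
    _ ≤ P N (Φ N).goodᶜ + (P N (Eev N) + (P N (Mev N) + (P N (Tev N) + P N (⋃ p : Fin n × Fin 3, Aev N p)))) := by
        refine (measure_union_le _ _).trans (add_le_add le_rfl ?_)
        refine (measure_union_le _ _).trans (add_le_add le_rfl ?_)
        refine (measure_union_le _ _).trans (add_le_add le_rfl ?_)
        exact measure_union_le _ _
    _ ≤ 0 + (ENNReal.ofReal (ε / 4) + (ENNReal.ofReal (ε / 4) + (ENNReal.ofReal (ε / 4) + ENNReal.ofReal (ε / 4)))) := by
        rw [hgood]
        exact add_le_add le_rfl (add_le_add hNE (add_le_add hNM (add_le_add (hT' N) hAsum)))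
    _ = ENNReal.ofReal ε := by
        rw [zero_add, ← ENNReal.ofReal_add (by positivity) (by positivity),
          ← ENNReal.ofReal_add (by positivity) (by positivity), ← ENNReal.ofReal_add (by positivity) (by positivity)]
        congr 1; ring

/-! ## The constant-profile mesoscopic LLN and the equilibrium rung, unconditionally -/

/-- [CL] **The constant-profile mesoscopic LLN with identified limit** (the conclusion of `mesoscopicLLN_const`, WITHOUT the route
item `MesoscopicLLN`) from the LANDED stubs [CL-ρ], [CL-v], [CL-asm] (by name): `σ₀ := min σ_[CL-ρ] (1/2)`; mass one from
`isProbabilityMeasure_localGibbsLaw`. [folklore] -/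
theorem constLLN_of :
    ∀ θ : ℝ, 0 < θ → ∃ σ₀ : ℝ, 0 < σ₀ ∧ ∀ σ : ℝ, 0 < σ → σ < σ₀ → ∀ Φ : Flows σ, (∀ N, IsProbabilityMeasure (Literature.MathematicalPhysics.KineticTheory.localGibbsLaw σ (fun _ => 1) (fun _ => 0) (fun _ => θ) N (Φ N))) ∧ ∀ (γ C : ℝ) (φ : ℕ → T3 → ℝ), 0 < γ → γ ≤ 1 / 15 → AdmissibleKernel γ C φ → ∀ δ : ℝ, 0 < δ → Tendsto (fun N : ℕ => Literature.MathematicalPhysics.KineticTheory.localGibbsLaw σ (fun _ => 1) (fun _ => 0) (fun _ => θ) N (Φ N) {z | δ < ∫ x, ((rhoB φ N z x - 1) ^ 2 + ‖mB φ N z x‖ ^ 2 + (EB φ N z x - 3 / 2 * θ) ^ 2)}) atTop (𝓝 0) := by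
  obtain ⟨σρ, hσρ, Hρ⟩ := stub_blockDensityLLNConst
  intro θ hθ
  refine ⟨min σρ (1 / 2), lt_min hσρ (by norm_num), fun σ hσ hlt Φ => ?_⟩
  have hltρ : σ < σρ := lt_of_lt_of_le hlt (min_le_left _ _)
  have hhalf : σ ≤ 1 / 2 := (lt_of_lt_of_le hlt (min_le_right _ _)).le
  refine ⟨fun N => Literature.MathematicalPhysics.KineticTheory.isProbabilityMeasure_localGibbsLaw
      continuous_const continuous_const continuous_const (fun _ => one_pos) (fun _ => hθ) hhalf N (Φ N),
    fun γ C φ hγ hγ' hadm δ hδ => ?_⟩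
  have hφc : ∀ N, Continuous (φ N) := fun N => (hadm.1 N).continuous
  exact stub_constLLN_of_parts σ θ Φ φ hφc
    (fun δ' hδ' => Hρ σ hσ hltρ θ hθ Φ γ C φ hγ hγ' hadm δ' hδ')
    (fun δ' hδ' => stub_blockVelocityLLNConst σ hσ hhalf θ hθ Φ γ C φ hγ hγ' hadm δ' hδ') δ hδ

/-- **THE EQUILIBRIUM RUNG OF THE CRUX, UNCONDITIONALLY** (registered helper of the line; no hypothesis). For every temperature `θ > 0` there is `σ₀ > 0`
such that for `0 < σ < σ₀` and EVERY hard-sphere flow family the crux's conclusion — the local-equilibrium closure of the collisional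
momentum + energy transfer tested against all smooth `(ψ, χ)`, uniformly in `τ ≤ t`, in probability — holds under the homogeneous local
Gibbs law of activity `1`, velocity `0`, temperature `θ` (`Disproof.EquilibriumRung` up to `Iff.rfl`). Inputs: LANDED theorems only — the stubs
[CL-ρ] p135857, [CL-v] p135595, [CL-asm] p134699, [R0c] p134580, [ERc] p134600 (constant-profile statics and two re-threadings of landed files),
the sibling crux at equilibrium `EvenStressEnskog.evenStressEnskog_rung0` (UNCONDITIONAL: two-cluster factorisation + labelled laws +
contact theorem), [PW-a], [PW-b], [MC], [TL], [E], [Z] (`noVirialBurstsConst_of`); `σ₀ := min σ_[WB]₀ σ_[ERc]`; the conclusion at `(σ, Φ)` is the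
crux's `let`-telescope (`conclusionAtFlow_iff`). [folklore assembly; H. Spohn (1991), Part I §2.3 for the context] -/
theorem equilibriumRungFlow_unconditional :
    ∀ θ : ℝ, 0 < θ → ∃ σ₀ : ℝ, 0 < σ₀ ∧ ∀ σ : ℝ, 0 < σ → σ < σ₀ → ∀ Φ : Flows σ,
      ConclusionAtFlow σ (fun _ => 1) (fun _ => θ) (fun _ => 0) Φ := by
  intro θ hθ
  have hRhs := stub_rhsSup_of_constLLN constLLN_of
  obtain ⟨σW, hσW, HW⟩ := noVirialBurstsConst_of
    Summit.AtomisticToContinuum.HydrodynamicLimit.Theorems.EvenStressEnskog.evenStressEnskog_rung0 θ hθ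
  obtain ⟨σS, hσS, HS⟩ := stub_equilibriumSup_of_rhsSup hRhs θ hθ
  refine ⟨min σW σS, lt_min hσW hσS, ?_⟩
  intro σ hσ hlt Φ
  have hltW : σ < σW := lt_of_lt_of_le hlt (min_le_left _ _)
  have hltS : σ < σS := lt_of_lt_of_le hlt (min_le_right _ _)
  rw [conclusionAtFlow_iff]
  intro γ C φ hγ hγ' hadm t ht ψ χ hψ hχ
  exact HS σ hσ hltS Φ t ht (HW σ hσ hltW Φ t ht) γ C φ hγ hγ' hadm ψ χ hψ hχ


end

end Summit.AtomisticToContinuum.HydrodynamicLimit.Theorems.HemisphereAffineSlaving
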